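import Summits.AnomalousDissipation.AnomalousDissipation.Cruxes.GalerkinFloor.Lines.birth
import Summits.AnomalousDissipation.AnomalousDissipation.Theorems.MomentParityResolvedDissipationTrajectoryUI
import Summits.AnomalousDissipation.AnomalousDissipation.Theorems.MomentParityResolvedDissipationTrajectoryUIOfLHEE
import Summits.AnomalousDissipation.AnomalousDissipation.Theorems.MomentParityResolvedDissipationSmallData
import Summits.AnomalousDissipation.AnomalousDissipation.Theorems.MomentParityGalerkinInvariantLoudStubKrylovBogoliubovTested
import Summits.AnomalousDissipation.AnomalousDissipation.Theorems.MomentParityGalerkinInvariantLoudStubKrylovBogoliubov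
import Summits.AnomalousDissipation.AnomalousDissipation.Theorems.TaylorCertificatesEnsembleCeilingTransfer
import Literature.Analysis.FluidPDE.TimeAverageEnstrophy

/-!
# Stub-ideation k = 2 (family RESHAPE) — helper signatures for `stub_fixedViscosityResolution`
# (crux stmt-AnomalousDissipation-1582 `DecimationAxis.GalerkinFloor`, skeleton `Lines/birth.lean`)

Scratch file of planner seat `sidea-stmt-AnomalousDissipation-1582-stub_fixedVisc-2`: the Lean signatures of the
helper lemmas named in `STUB-IDEAS-stub_fixedViscosityResolution-2.md`.  Nothing here is registered; `sorry` marks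
the helpers a stub prover would prove, the corollaries at the end are real compositions (they show that the
by-name reductions typecheck).

PLAN A (top): transfer the trajectory-currency stub onto the landed ENSEMBLE resolution stack of
stmt-AnomalousDissipation-14284 (`MomentParity.ResolvedDissipation`) by a Krylov–Bogoliubov law of a BAD trajectory
taken with a generalized limit realising the `liminf` of its resolved dissipation.
-/

set_option linter.dupNamespace false
set_option linter.unusedVariables false

noncomputable section

open MeasureTheory Filter Topology Set
open scoped ENNReal
open Literature.Analysis.FunctionSpaces Literature.Analysis.FunctionSpaces.Torus Literature.Analysis.FluidPDE
open Summit.AnomalousDissipation.AnomalousDissipation.Theorems.CubicParityLoud.Negative (T3 R3 H3)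
open Summit.AnomalousDissipation.AnomalousDissipation.Theorems.QuarticGate.Negative
  (IsLevel IsBandTest polyGrad IsPolyStationary)
open Summit.AnomalousDissipation.AnomalousDissipation.Theorems.MomentLadder.Negative (IsResolved)
open Summit.AnomalousDissipation.AnomalousDissipation.Cruxes.GalerkinFloor.Birth

namespace Summit.AnomalousDissipation.AnomalousDissipation.Cruxes.GalerkinFloor.StubIdeas2

/-- Frequency lattice `ℤ³`. -/
local notation "ℤ³" => Fin 3 → ℤ
/-- Complex coefficient vectors `ℂ³`. -/
local notation "ℂ³" => EuclideanSpace ℂ (Fin 3)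

/-! ## §0 The two bodies, at one `(f, ν, R)` resp. one `(ν, N, g)` -/

/-- **RD-at.** The body of `MomentParity.ResolvedDissipation` (stmt-14284) at ONE force / viscosity / radius, in the
`IsLevel / IsPolyStationary / IsResolved` vocabulary: literally the conclusion type of the landed
`TrajectoryUI.resolvedAt_of_trajectoryUI` and `resolvedDissipation_of_uniformIntegrability`. -/
def ResolvedAt (f : T3 → R3) (ν R : ℝ) : Prop :=
  ∃ κ : ℕ → ℕ, ∀ (N : ℕ) (μ : Measure (Torus.energySpace (Fin 3))), IsProbabilityMeasure μ →
    (∀ᵐ u ∂μ, IsLevel N u) → (∀ᵐ u ∂μ, ‖u‖ ≤ R) → (∀ d : ℕ, IsPolyStationary ν f N d μ) → IsResolved κ μ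

/-- **Stub-at.** The body of `stub_fixedViscosityResolution` at ONE viscosity and ONE designer force. -/
def FixedViscosityResolutionAt (ν : ℝ) (N : ℕ) (g : ℤ³ → ℂ³) : Prop :=
  ∀ (E ε δ : ℝ), 0 < δ → ∃ M : ℕ, ∀ (K : ℕ) (S : Finset ℤ³), S = (freqBall K).erase 0 →
    ∀ c : ℝ → ↥S → ℂ³, IsCoeffTrajectory S ν g c →
      longTimeAvgSup (coeffEnergy c) ≤ E → ε ≤ longTimeAvgInf (coeffDissipation ν c) →
        ε - δ ≤ longTimeAvgInf (coeffResolvedDissipation ν M c)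

/-- The registered stub is `∀ ν > 0, ∀ designer (N, g), FixedViscosityResolutionAt ν N g` (definitional). -/
theorem stub_iff : Statement.stub_fixedViscosityResolution ↔
    ∀ ν : ℝ, 0 < ν → ∀ (N : ℕ) (g : ℤ³ → ℂ³), IsDesignerForce N g → FixedViscosityResolutionAt ν N g :=
  Iff.rfl

/-! ## §A0 Dictionary: designer force ↦ steady field force -/

/-- The field of a designer force, `f_g := Σ_{k ∈ freqBall N} g_k e_k` (real since `g` is conjugation-symmetric). -/
def designerField (N : ℕ) (g : ℤ³ → ℂ³) : T3 → R3 :=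
  realTrigPoly (freqBall N) g

/-- A `K`-UNIFORM absorbing radius for trajectories driven by `g` at viscosity `ν`: the laminar radius
`‖f_g‖₂ / (4π²ν)` plus one (strictly larger than the `limsup`, so every trajectory ENTERS the ball). -/
def absorbRadius (ν : ℝ) (N : ℕ) (g : ℤ³ → ℂ³) : ℝ :=
  Real.sqrt (∑ k ∈ freqBall N, ‖g k‖ ^ 2) / (4 * Real.pi ^ 2 * ν) + 1

section A0
variable {N : ℕ} {g : ℤ³ → ℂ³}

/-- A0.1 `f_g` is smooth (a trigonometric polynomial; `isSmooth_realTrigPoly`). -/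
theorem designerField_isSmooth (hg : IsDesignerForce N g) : Torus.IsSmooth (designerField N g) := by
  sorry

/-- A0.2 `f_g` is divergence free (transversality clause of `IsDesignerForce`; `isDivFree_realTrigPoly`). -/
theorem designerField_isDivFree (hg : IsDesignerForce N g) : Torus.IsDivFree (designerField N g) := by
  sorry

/-- A0.3 `f_g` has zero mean (`g 0 = 0`). -/
theorem designerField_hasZeroMean (hg : IsDesignerForce N g) : Torus.HasZeroMean (designerField N g) := by
  sorry

/-- A0.4 Parseval: `‖f_g‖₂² = Σ_k ‖g_k‖²` (`integral_norm_sq_realTrigPoly`, conj-symmetry from `IsDesignerForce`). -/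
theorem integral_norm_sq_designerField (hg : IsDesignerForce N g) :
    ∫ x, ‖designerField N g x‖ ^ 2 = ∑ k ∈ freqBall N, ‖g k‖ ^ 2 := by
  sorry

/-- A0.5 The Galerkin force coefficients of `f_g` at ANY level `K` are `g` itself (`mFourierCoeff_realTrigPoly`,
`g = 0` off `freqBall N`). -/
theorem fourierRestrict_designerField (hg : IsDesignerForce N g) (K : ℕ) (k : ↥(freqBall (d := Fin 3) K)) :
    fourierRestrict (freqBall K) (designerField N g) k = g k := by
  sorry

end A0

/-! ## §A1 Dictionary: coefficient trajectory on `freqBall K ∖ {0}` ↦ Galerkin ODE solution on `freqBall K` -/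

/-- Zero-extension of a coefficient vector on `freqBall K ∖ {0}` to `freqBall K` (mean mode `:= 0`). -/
def extendZero {K : ℕ} (v : ↥((freqBall (d := Fin 3) K).erase 0) → ℂ³) : ↥(freqBall (d := Fin 3) K) → ℂ³ :=
  fun k => if h : (k : ℤ³) ∈ (freqBall (d := Fin 3) K).erase 0 then v ⟨k, h⟩ else 0

section A1
variable {ν : ℝ} {N K : ℕ} {g : ℤ³ → ℂ³} {c : ℝ → ↥((freqBall (d := Fin 3) K).erase 0) → ℂ³}

/-- A1.1 (the one algebraic risk, S/M) **erase-zero ⊂ ball**: for a real solenoidal coefficient vector `v` on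
`freqBall K ∖ {0}` and a force with `g 0 = 0`, the exact-coupling right-hand side on the punctured ball is the
restriction of the right-hand side on the full ball at the zero-extended vector, and the latter VANISHES at the mean
mode (the extra convection pairs have `l = 0` or `m = 0`, where the extended vector is zero; at `k = 0` the sum over
`l + m = 0` is `Σ_l 2πi (v_l · (−l)) v_{−l} = 0` termwise by transversality, `leraySym_zero_freq`). -/
theorem galerkinRHS_extendZero (hg : IsDesignerForce N g) (v : ↥((freqBall (d := Fin 3) K).erase 0) → ℂ³)
    (hv : v ∈ galerkinSubspace ((freqBall (d := Fin 3) K).erase 0)) :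
    (∀ k : ↥((freqBall (d := Fin 3) K).erase 0),
        galerkinRHS (freqBall K) ν (fun k => g k) (extendZero v) ⟨k, Finset.mem_of_mem_erase k.2⟩ =
          galerkinRHS ((freqBall K).erase 0) ν (fun k => g k) v k) ∧
      galerkinRHS (freqBall K) ν (fun k => g k) (extendZero v) ⟨0, zero_mem_freqBall K⟩ = 0 := by
  sorry

/-- A1.2 (M) **the embedding**: the zero-extension of a stub trajectory is a global solution of the tree's Galerkin
ODE on `freqBall K` driven by the Fourier restriction of `f_g` (`= g`, A0.5), with vanishing mean mode. -/
theorem isGalerkinODESolution_extendZero (hg : IsDesignerForce N g)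
    (hc : IsCoeffTrajectory ((freqBall K).erase 0) ν g c) :
    IsGalerkinODESolution ν (fourierRestrict (freqBall K) (designerField N g)) (extendZero (c 0))
        (fun t => extendZero (c t)) ∧
      ∀ t, extendZero (c t) ⟨0, zero_mem_freqBall K⟩ = 0 := by
  sorry

/-- A1.3 (S) functional dictionary, total dissipation: `coeffDissipation = ν‖∇u‖₂²` of the lifted field
(`toReal_eGradNormSq_realTrigPoly`). -/
theorem coeffDissipation_eq_lift (hcm : ∀ t, c t ∈ galerkinSubspace ((freqBall (d := Fin 3) K).erase 0)) (t : ℝ) :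
    coeffDissipation ν c t =
      ν * (eGradNormSq (realTrigPoly (freqBall K) (coeffExt (freqBall K) (extendZero (c t))))).toReal := by
  sorry

/-- A1.4 (S) functional dictionary, resolved dissipation: `coeffResolvedDissipation ν M = ν‖∇P_M u‖₂²`
(`freqBall M = {|k|² ≤ M²}` is exactly the `if freqNormSq k ≤ M^2` cut; `fourierTruncate M ∘ realTrigPoly`). -/
theorem coeffResolvedDissipation_eq_lift (hcm : ∀ t, c t ∈ galerkinSubspace ((freqBall (d := Fin 3) K).erase 0))
    (M : ℕ) (t : ℝ) :
    coeffResolvedDissipation ν M c t =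
      ν * (eGradNormSq (fourierTruncate M
        (realTrigPoly (freqBall K) (coeffExt (freqBall K) (extendZero (c t)))))).toReal := by
  sorry

/-- A1.5 (S) functional dictionary, energy: `coeffEnergy = ‖u‖₂²` (Parseval `integral_norm_sq_realTrigPoly`). -/
theorem coeffEnergy_eq_lift (hcm : ∀ t, c t ∈ galerkinSubspace ((freqBall (d := Fin 3) K).erase 0)) (t : ℝ) :
    coeffEnergy c t = ∫ x, ‖realTrigPoly (freqBall K) (coeffExt (freqBall K) (extendZero (c t))) x‖ ^ 2 := by
  sorry

/-- A1.6 (S/M) **attraction** (`K`-uniform, datum-independent radius): every stub trajectory ENTERS the absorbing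
ball `‖c‖ ≤ absorbRadius ν N g` in finite time and stays (energy inequality `ψ' ≤ −4π²ν ψ + ‖g‖ √ψ`, Poincaré on
`k ≠ 0`; cf. `energy_le_of_isGalerkinODESolution`, `stub_absorbingBall`, Mathlib Gronwall). -/
theorem exists_forall_coeffEnergy_le (hν : 0 < ν) (hg : IsDesignerForce N g)
    (hc : IsCoeffTrajectory ((freqBall K).erase 0) ν g c) :
    ∃ t₀ : ℝ, 0 ≤ t₀ ∧ ∀ t, t₀ ≤ t → coeffEnergy c t ≤ absorbRadius ν N g ^ 2 := by
  sorry

end A1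

/-! ## §A2 The bad law: Krylov–Bogoliubov with a generalized limit realising a `liminf` -/

section A2
variable {ν : ℝ} {N K : ℕ} {g : ℤ³ → ℂ³} {c : ℝ → ↥((freqBall (d := Fin 3) K).erase 0) → ℂ³}

/-- A2.1 (S) a generalized limit attaining the `liminf` of one eventually bounded function
(`Theorems.exists_generalizedLimit_apply_eq_limsup` applied to `-h`, linearity). -/
theorem exists_generalizedLimit_apply_eq_liminf {h : ℝ → ℝ}
    (hb₁ : IsBoundedUnder (· ≤ ·) atTop h) (hb₂ : IsBoundedUnder (· ≥ ·) atTop h) :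
    ∃ Λ : GeneralizedLimit, Λ h = liminf h atTop := by
  sorry

/-- A2.2 (M/L) **the bad law.** A stub trajectory at `(ν, g)` on `freqBall K ∖ {0}` whose `liminf`-mean resolved
dissipation below `M` is `< e₁` while its `liminf`-mean total dissipation is `≥ e₂` has a Krylov–Bogoliubov law
which is ADMISSIBLE for RD at `(f_g, ν, absorbRadius)` — probability, level `K`, supported in the absorbing ball,
all-order polynomially stationary — with `ν ∫ ‖∇P_M u‖² dμ ≤ e₁` and `e₂ ≤ ν ∫ ‖∇u‖² dμ`.
Proof plan: lift (A1.2) to a tested path `U` in `H` (`hasDerivAt_pairing_lift` → time-integrated tested form),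
`Λ` realising `liminf (timeMean D_M)` (A2.1), `μ` its time-average measure
(`KrylovBogoliubovTested.stub_krylovBogoliubov`: exists + `IsInvariant`, hence `∀ d, IsPolyStationary`), support
from A1.6 + `IsTimeAverageMeasure.measure_compl_eq_zero`, the two integrals by
`integral_eq_longTimeAvg_of_continuous` (`D_M`, `D_tot` continuous on the compact level ball,
`continuous_galerkinEnstrophy` / `continuous_bandEnstrophy`) and `Λ ≥ liminf` (`GeneralizedLimit.liminf_le`). -/
theorem exists_badLaw (hν : 0 < ν) (hg : IsDesignerForce N g)
    (hc : IsCoeffTrajectory ((freqBall K).erase 0) ν g c) (M : ℕ) {e₁ e₂ : ℝ}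
    (h₁ : longTimeAvgInf (coeffResolvedDissipation ν M c) < e₁)
    (h₂ : e₂ ≤ longTimeAvgInf (coeffDissipation ν c)) :
    ∃ μ : Measure (Torus.energySpace (Fin 3)), IsProbabilityMeasure μ ∧ (∀ᵐ u ∂μ, IsLevel K u) ∧
      (∀ᵐ u ∂μ, ‖u‖ ≤ absorbRadius ν N g) ∧ (∀ d : ℕ, IsPolyStationary ν (designerField N g) K d μ) ∧
      ν * (∫⁻ u, eGradNormSq (fourierTruncate M (u.1 : T3 → R3)) ∂μ).toReal ≤ e₁ ∧
      e₂ ≤ ν * (∫⁻ u, eGradNormSq (u.1 : T3 → R3) ∂μ).toReal ∧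
      ∫⁻ u, eGradNormSq (u.1 : T3 → R3) ∂μ ≠ ⊤ := by
  sorry

end A2

/-! ## §A3 The transfer and its by-name corollaries -/

section A3
variable {ν : ℝ} {N : ℕ} {g : ℤ³ → ℂ³}

/-- A3 (M) **RD-at ⟹ stub-at** at the same `(ν, g)`: given the resolution schedule `κ` of RD at
`(f_g, ν, absorbRadius)`, take `n` with `ν/(n+1) < δ` and `M := κ n`; a violating trajectory would have a bad law
(A2.2 with `e₁ := ε − δ`, `e₂ := ε`) whose `κ`-resolution at `n` reads `ν∫Z ≤ ν∫Z_{≤M} + ν/(n+1) < ε`. The energy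
hypothesis of the stub is not used. -/
theorem fixedViscosityResolutionAt_of_resolvedAt (hν : 0 < ν) (hg : IsDesignerForce N g)
    (hRD : ResolvedAt (designerField N g) ν (absorbRadius ν N g)) : FixedViscosityResolutionAt ν N g := by
  sorry

/-- RD (all-order stationarity clause, unfolded) gives RD-at (graded clause `∀ d, IsPolyStationary`):
take `d := deg P + 1`. -/
theorem resolvedAt_of_resolvedDissipation (h : Theses.MomentParity.ResolvedDissipation) {f : T3 → R3}
    (hs : Torus.IsSmooth f) (hd : Torus.IsDivFree f) (hz : Torus.HasZeroMean f) (hν : 0 < ν) (R : ℝ) :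
    ResolvedAt f ν R := by
  obtain ⟨κ, hκ⟩ := h f hs hd hz ν hν R
  exact ⟨κ, fun N μ hμ hL hB hS => hκ N μ hμ hL hB fun m g P hg => hS (P.totalDegree + 1) m g P hg le_rfl⟩

/-- **C1. `ResolvedDissipation` (stmt-14284) ⟹ the stub, BY NAME** (dedup edge for the registered stub). -/
theorem stub_of_resolvedDissipation (h : Theses.MomentParity.ResolvedDissipation) :
    Statement.stub_fixedViscosityResolution := by
  intro ν hν N g hg
  exact fixedViscosityResolutionAt_of_resolvedAt hν hg (resolvedAt_of_resolvedDissipation h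
    (designerField_isSmooth hg) (designerField_isDivFree hg) (designerField_hasZeroMean hg) hν _)

/-- **C2. trajectory UI at `(f_g, ν, absorbRadius)` ⟹ stub-at `(ν, g)`** (landed `resolvedAt_of_trajectoryUI`). -/
theorem fixedViscosityResolutionAt_of_trajectoryUI (hν : 0 < ν) (hg : IsDesignerForce N g)
    (hTUI : ∃ T : ℝ, 0 < T ∧
        ∀ G : ℝ≥0∞, G ≠ ⊤ → ∀ ε : ℝ≥0∞, 0 < ε → ∃ M : ℝ≥0∞, M ≠ ⊤ ∧
          ∀ (K : ℕ) (a : T3 → R3), IsGalerkinMode K a → Torus.HasZeroMean a →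
            ∫ x, ‖a x‖ ^ 2 ≤ absorbRadius ν N g ^ 2 → eGradNormSq a ≤ G →
            ∫⁻ t in Set.Ioo 0 T, (Set.Ioi M).indicator id
                (eGradNormSq (Torus.galerkinFlow ν (designerField N g) K t a)) ≤ ε) :
    FixedViscosityResolutionAt ν N g :=
  fixedViscosityResolutionAt_of_resolvedAt hν hg
    (Theorems.MomentParityResolvedDissipation.TrajectoryUI.resolvedAt_of_trajectoryUI _
      (designerField_isSmooth hg) (designerField_hasZeroMean hg) ν hν _ hTUI)

/-- **C3. Leray–Hopf energy EQUALITY at `(ν, f_g)` ⟹ stub-at `(ν, g)`** (landed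
`trajectoryUIAt_of_lerayHopfEnergyEquality`, p162969 chain): the stub at one viscosity is implied by the classical
fixed-ν conjecture for ONE smooth steady force. -/
theorem fixedViscosityResolutionAt_of_lerayHopfEnergyEquality (hν : 0 < ν) (hg : IsDesignerForce N g)
    (hLHEE : ∀ (u₀ : T3 → R3) (u : ℝ → T3 → R3),
      Torus.IsGlobalLerayHopf ν (fun _ => designerField N g) u₀ u →
      ∀ (t₀ t₁ : ℝ), 0 < t₀ → t₀ ≤ t₁ →
        Torus.kineticEnergy (u t₁) + ν * (∫⁻ τ in Set.Ioo t₀ t₁, eGradNormSq (u τ)).toReal =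
          Torus.kineticEnergy (u t₀) + ∫ τ in t₀..t₁, ∫ x, inner ℝ (designerField N g x) (u τ x)) :
    FixedViscosityResolutionAt ν N g :=
  fixedViscosityResolutionAt_of_trajectoryUI hν hg
    (Theorems.MomentParityResolvedDissipation.TrajectoryUIOfLHEE.trajectoryUIAt_of_lerayHopfEnergyEquality hν
      (designerField_isSmooth hg) (designerField_hasZeroMean hg) hLHEE _)

/-- **C4. UNCONDITIONAL LAMINAR RUNG of the stub**: `Σ_k ‖g_k‖² ≤ ν⁴/16 ⟹ stub-at (ν, g)` (landed
`uniformIntegrability_smallForce` + `resolvedDissipation_of_uniformIntegrability`). -/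
theorem fixedViscosityResolutionAt_smallForce (hν : 0 < ν) (hg : IsDesignerForce N g)
    (hsmall : ∑ k ∈ freqBall N, ‖g k‖ ^ 2 ≤ ν ^ 4 / 16) : FixedViscosityResolutionAt ν N g :=
  fixedViscosityResolutionAt_of_resolvedAt hν hg
    (Theorems.MomentParityResolvedDissipation.resolvedDissipation_of_uniformIntegrability _
      (designerField_isSmooth hg) ν hν _
      (Theorems.MomentParityResolvedDissipation.uniformIntegrability_smallForce _ (designerField_isSmooth hg) ν hν
        (by rw [integral_norm_sq_designerField hg]; exact hsmall) _))

end A3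

/-! ## §B Plan B helpers (measure-free): windows of trajectory UI → long-time means -/

section B
variable {ν : ℝ} {N K : ℕ} {g : ℤ³ → ℂ³} {c : ℝ → ↥((freqBall (d := Fin 3) K).erase 0) → ℂ³}

/-- B1 (S) pointwise TAIL SPLIT: with `Z` the enstrophy, `P` the palinstrophy and `tail` the enstrophy above `M`,
`tail ≤ Z·1{Z > Λ} + (1+Λ)² M⁻² · P/(1+Z)²`. -/
theorem tail_split {Z P tail Λ M : ℝ} (hM : 0 < M) (hZ : 0 ≤ Z) (hP : 0 ≤ P) (hΛ : 0 ≤ Λ) (ht0 : 0 ≤ tail)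
    (htZ : tail ≤ Z) (htP : tail ≤ P / M ^ 2) :
    tail ≤ (if Λ < Z then Z else 0) + (1 + Λ) ^ 2 / M ^ 2 * (P / (1 + Z) ^ 2) := by
  sorry

/-- B2 (S/M) `liminf` ARITHMETIC for long-time means: `f = r + h` with `r, h ≥ 0` locally integrable and bounded
running means gives `⟨f⟩⁻ − ⟨h⟩⁺ ≤ ⟨r⟩⁻` (`timeMean_add`, `Filter.liminf_add_le`-type bookkeeping). -/
theorem longTimeAvgInf_sub_longTimeAvgSup_le {f r h : ℝ → ℝ} (hf : ∀ t, f t = r t + h t) (hr : ∀ t, 0 ≤ r t)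
    (hh : ∀ t, 0 ≤ h t) (hri : ∀ T, 0 < T → IntegrableOn r (Ioc 0 T)) (hhi : ∀ T, 0 < T → IntegrableOn h (Ioc 0 T))
    (hb : IsBoundedUnder (· ≤ ·) atTop (timeMean f)) :
    longTimeAvgInf f - longTimeAvgSup h ≤ longTimeAvgInf r := by
  sorry

/-- B3 (M) LONG-TIME PATHWISE FGT (Foias–Guillopé–Temam along one trajectory, `K`-uniform): the long-time mean of
`P/(1+Z)²` along a stub trajectory is bounded by a constant of `(ν, g)` only (window bound `stub_pathwiseFGT` /
`fgt_integral_bound` is affine in the window length; chain windows from the absorbing ball, A1.6). -/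
theorem longTimeAvgSup_fgt_le (hν : 0 < ν) (hg : IsDesignerForce N g) :
    ∃ C : ℝ, ∀ (K : ℕ) (c : ℝ → ↥((freqBall (d := Fin 3) K).erase 0) → ℂ³),
      IsCoeffTrajectory ((freqBall K).erase 0) ν g c →
      longTimeAvgSup (fun t =>
        (4 * Real.pi ^ 2 * ∑ k : ↥((freqBall (d := Fin 3) K).erase 0), freqNormSq (k : ℤ³) ^ 2 * ‖c t k‖ ^ 2) /
          (1 + 4 * Real.pi ^ 2 * ∑ k : ↥((freqBall (d := Fin 3) K).erase 0), freqNormSq (k : ℤ³) * ‖c t k‖ ^ 2) ^ 2) ≤ C := by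
  sorry

/-- B4 (L, the load-bearing Plan-B helper) WINDOWED TRAJECTORY UI ⟹ LONG-TIME SUPERLEVEL MEANS SMALL, uniformly in
`K` and in the trajectory: from TUI at `(f_g, ν, absorbRadius)` (windows `[0,T]` from data in the ball with
`Z ≤ G`), by OFFSET-AVERAGED window chaining (`∫₀ᵀ #{i : Z(iT+θ) > G} dθ ≤ |{Z > G} ∩ [0,(n+1)T]|`, Chebyshev on
the mean enstrophy `⟨Z⟩ ≤ ‖f_g‖ R/ν`, bad windows bounded by the pathwise energy identity). -/
theorem longTimeAvgSup_superlevel_le_of_trajectoryUI (hν : 0 < ν) (hg : IsDesignerForce N g)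
    (hTUI : ∃ T : ℝ, 0 < T ∧
        ∀ G : ℝ≥0∞, G ≠ ⊤ → ∀ ε : ℝ≥0∞, 0 < ε → ∃ M : ℝ≥0∞, M ≠ ⊤ ∧
          ∀ (K : ℕ) (a : T3 → R3), IsGalerkinMode K a → Torus.HasZeroMean a →
            ∫ x, ‖a x‖ ^ 2 ≤ absorbRadius ν N g ^ 2 → eGradNormSq a ≤ G →
            ∫⁻ t in Set.Ioo 0 T, (Set.Ioi M).indicator id
                (eGradNormSq (Torus.galerkinFlow ν (designerField N g) K t a)) ≤ ε)
    (η : ℝ) (hη : 0 < η) :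
    ∃ Λ : ℝ, ∀ (K : ℕ) (c : ℝ → ↥((freqBall (d := Fin 3) K).erase 0) → ℂ³),
      IsCoeffTrajectory ((freqBall K).erase 0) ν g c →
      longTimeAvgSup (fun t =>
        if Λ < 4 * Real.pi ^ 2 * ∑ k : ↥((freqBall (d := Fin 3) K).erase 0), freqNormSq (k : ℤ³) * ‖c t k‖ ^ 2 then
          coeffDissipation ν c t else 0) ≤ η := by
  sorry

end B

/-! ## §C Plan C (regime split): the two trivial sectors -/

section C
variable {ν : ℝ} {N : ℕ} {g : ℤ³ → ℂ³}

/-- C.1 (S) `δ ≥ ε`: the resolved dissipation is nonnegative, so `ε − δ ≤ 0 ≤ ⟨D_M⟩⁻` for ANY `M`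
(`timeMean_nonneg`, `le_liminf_of_le` with the cobound from nonnegativity). -/
theorem fixedViscosityResolutionAt_of_le {E ε δ : ℝ} (hδε : ε ≤ δ) (M K : ℕ) (S : Finset ℤ³)
    (hS : S = (freqBall K).erase 0) (c : ℝ → ↥S → ℂ³) (hc : IsCoeffTrajectory S ν g c) :
    ε - δ ≤ longTimeAvgInf (coeffResolvedDissipation ν M c) := by
  sorry

/-- C.2 (M) the LOUDNESS CEILING: by the time-averaged exact energy identity and Cauchy–Schwarz,
`⟨D_tot⟩⁻ ≤ ‖g‖ √E` whenever `⟨En⟩⁺ ≤ E`; so the stub is VACUOUS (no admissible trajectory) for `ε > ‖g‖√E`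
(`sum_re_inner_galerkinRHS_self`, `hasDerivWithinAt_energy`). -/
theorem longTimeAvgInf_coeffDissipation_le (hν : 0 < ν) (hg : IsDesignerForce N g) {K : ℕ} {E : ℝ} (hE : 0 ≤ E)
    (c : ℝ → ↥((freqBall (d := Fin 3) K).erase 0) → ℂ³) (hc : IsCoeffTrajectory ((freqBall K).erase 0) ν g c)
    (hEn : longTimeAvgSup (coeffEnergy c) ≤ E) :
    longTimeAvgInf (coeffDissipation ν c) ≤ Real.sqrt (∑ k ∈ freqBall N, ‖g k‖ ^ 2) * Real.sqrt E := by
  sorry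

end C

end Summit.AnomalousDissipation.AnomalousDissipation.Cruxes.GalerkinFloor.StubIdeas2

end
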